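import Mathlib
import Summits.NavierStokesRegularity.NavierStokesRegularity.Theorems.EulerZoomLiouvillePowerGaugeEulerLiouvilleDSSNodeConvergence
import HarnessLib.Audit

/-!
# Crux E `PowerGaugeEulerLiouville` (stmt-NavierStokesRegularity-19832): THE CLUSTER SET OF A RESTING TRAJECTORY IS CONNECTED — so COUNTABLY many permanent
# nodes per ball already force convergence to one node (width seat ns-cas-k2 g3, lane «DSS thin vortical nodes», tool C part 5)

Route `EulerZoomLiouville` (NavierStokesRegularity), crux E.  Upgrade of `…DSSNodeConvergence` (`exists_tendsto_lattice_of_finite_nodes`): the phase-lattice similarity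
positions `Y j` of a confined resting trajectory move by `o(1)` per period, so their cluster set is a CONNECTED compact set of permanent nodes; a connected subset of a
countable set is a point.
* `isPreconnected_setOf_mapClusterPt` — generic: a sequence in a compact set of a metric space with `dist(Y_{j+1}, Y_j) → 0` has a preconnected cluster set;
* `tendsto_of_forall_mapClusterPt_eq` — generic: a sequence in a compact set all of whose cluster points equal `y*` converges to `y*`;
* **`exists_tendsto_lattice_of_countable_nodes`** — `(u,p)` classical, `l`-DSS; `X` confined and resting; the permanent nodes of the ball `‖y‖ ≤ R` COUNTABLE ⇒ the
  phase-lattice similarity positions converge to a permanent node of the ball.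

WHAT THIS IS NOT: not NS regularity, not the crux E — Lagrangian bookkeeping for hypothetical DSS blow-up members; 19832 is OPEN. [folklore]
-/

noncomputable section

set_option linter.dupNamespace false

open MeasureTheory Set Filter Topology Metric Function
open scoped NNReal ENNReal ContDiff InnerProductSpace RealInnerProductSpace

namespace Summit.NavierStokesRegularity.NavierStokesRegularity.Theorems.PowerGaugeEulerLiouville.DSSNodes

open Literature.Analysis Literature.Analysis.FluidPDE
open Summit.NavierStokesRegularity.NavierStokesRegularity.Theorems.PowerGaugeEulerLiouville.SimilarityBernoulli

/-! ### Generic: slowly varying sequences have connected cluster sets -/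

section Generic

variable {α : Type*} [MetricSpace α]

/-- Cluster points of a sequence in a closed set lie in it. [folklore] -/
theorem mem_of_mapClusterPt_of_isClosed {Y : ℕ → α} {K : Set α} (hK : IsClosed K) (hYK : ∀ j, Y j ∈ K) {z : α}
    (hz : MapClusterPt z atTop Y) : z ∈ K := by
  obtain ⟨ψ, -, hψ⟩ := hz.tendsto_subseq
  exact hK.mem_of_tendsto hψ (Eventually.of_forall fun j => hYK (ψ j))

/-- **SLOWLY VARYING SEQUENCES HAVE CONNECTED CLUSTER SETS.**  `Y : ℕ → α` with values in a compact set `K` and `dist(Y_{j+1}, Y_j) → 0`: the set of cluster points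
of `Y` is preconnected.  (If it split into two closed pieces at distance `2δ`, the sequence would eventually live in the `δ/2`-thickening of one of them — steps
`< δ/2` cannot cross the gap — contradicting a cluster point in the other.) [folklore] -/
theorem isPreconnected_setOf_mapClusterPt {Y : ℕ → α} {K : Set α} (hK : IsCompact K) (hYK : ∀ j, Y j ∈ K)
    (hstep : Tendsto (fun j => dist (Y (j + 1)) (Y j)) atTop (𝓝 0)) :
    IsPreconnected {z : α | MapClusterPt z atTop Y} := by
  set C : Set α := {z : α | MapClusterPt z atTop Y} with hC
  have hCcl : IsClosed C := by
    show IsClosed {z : α | ClusterPt z (map Y atTop)}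
    exact isClosed_setOf_clusterPt
  have hCK : C ⊆ K := fun z hz => mem_of_mapClusterPt_of_isClosed hK.isClosed hYK hz
  have hCc : IsCompact C := hK.of_isClosed_subset hCcl hCK
  rw [isPreconnected_closed_iff]
  intro t t' ht ht' hcover hAt hBt
  by_contra hne
  set A : Set α := C ∩ t with hA
  set B : Set α := C ∩ t' with hB
  have hAc : IsCompact A := hCc.inter_right ht
  have hBcl : IsClosed B := hCcl.inter ht'
  have hdisj : Disjoint A B := by
    rw [Set.disjoint_iff]
    rintro z ⟨⟨hzC, hzt⟩, ⟨-, hzt'⟩⟩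
    exact hne ⟨z, hzC, hzt, hzt'⟩
  obtain ⟨δ, hδ, hthick⟩ := hdisj.exists_thickenings hAc hBcl
  have hδ2 : 0 < δ / 2 := half_pos hδ
  -- no point is `δ/2`-close to `A` and `δ/2`-close (even `δ`-close) to `B`
  have hsep : ∀ x, x ∈ thickening δ A → x ∈ thickening δ B → False := fun x hxA hxB =>
    (Set.disjoint_iff.1 hthick) ⟨hxA, hxB⟩
  -- step 1: eventually `Y j` is `δ/2`-close to `A ∪ B = C`
  set U : Set α := thickening (δ / 2) A ∪ thickening (δ / 2) B with hU
  have hUo : IsOpen U := isOpen_thickening.union isOpen_thickening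
  have hCU : C ⊆ U := by
    intro z hz
    rcases hcover hz with hzt | hzt'
    · exact Or.inl (mem_thickening_iff.2 ⟨z, ⟨hz, hzt⟩, by simpa using hδ2⟩)
    · exact Or.inr (mem_thickening_iff.2 ⟨z, ⟨hz, hzt'⟩, by simpa using hδ2⟩)
  have hev : ∀ᶠ j in atTop, Y j ∈ U := by
    by_contra hcon
    rw [not_eventually] at hcon
    obtain ⟨φ, hφ, hφP⟩ := extraction_of_frequently_atTop hcon
    have hK' : IsCompact (K \ U) := hK.diff hUo
    obtain ⟨z, hzK', ψ, hψ, hlim⟩ := hK'.tendsto_subseq (x := Y ∘ φ) fun j => ⟨hYK _, hφP j⟩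
    have hzC : z ∈ C := by
      have h1 : MapClusterPt z atTop ((Y ∘ φ) ∘ ψ) := hlim.mapClusterPt
      exact (h1.of_comp hψ.tendsto_atTop).of_comp hφ.tendsto_atTop
    exact hzK'.2 (hCU hzC)
  -- step 2: small steps
  have hsmall : ∀ᶠ j in atTop, dist (Y (j + 1)) (Y j) < δ / 2 :=
    hstep.eventually (gt_mem_nhds hδ2)
  obtain ⟨J, hJ⟩ := eventually_atTop.1 (hev.and hsmall)
  -- step 3: no crossing
  have hstayA : Y J ∈ thickening (δ / 2) A → ∀ i, Y (J + i) ∈ thickening (δ / 2) A := by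
    intro h0 i
    induction i with
    | zero => simpa using h0
    | succ i ih =>
        obtain ⟨hU', hd⟩ := hJ (J + (i + 1)) (by omega)
        rcases hU' with h | h
        · exact h
        · exfalso
          obtain ⟨a, haA, hda⟩ := mem_thickening_iff.1 ih
          have hd' : dist (Y (J + i + 1)) (Y (J + i)) < δ / 2 := (hJ (J + i) (by omega)).2
          have h1 : Y (J + (i + 1)) ∈ thickening δ A := mem_thickening_iff.2 ⟨a, haA, by
            rw [show J + (i + 1) = J + i + 1 by ring]
            calc dist (Y (J + i + 1)) a ≤ dist (Y (J + i + 1)) (Y (J + i)) + dist (Y (J + i)) a := dist_triangle _ _ _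
              _ < δ / 2 + δ / 2 := add_lt_add hd' hda
              _ = δ := by ring⟩
          exact hsep _ h1 (thickening_mono (by linarith) _ h)
  have hstayB : Y J ∈ thickening (δ / 2) B → ∀ i, Y (J + i) ∈ thickening (δ / 2) B := by
    intro h0 i
    induction i with
    | zero => simpa using h0
    | succ i ih =>
        obtain ⟨hU', hd⟩ := hJ (J + (i + 1)) (by omega)
        rcases hU' with h | h
        · exfalso
          obtain ⟨b, hbB, hdb⟩ := mem_thickening_iff.1 ih
          have hd' : dist (Y (J + i + 1)) (Y (J + i)) < δ / 2 := (hJ (J + i) (by omega)).2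
          have h1 : Y (J + (i + 1)) ∈ thickening δ B := mem_thickening_iff.2 ⟨b, hbB, by
            rw [show J + (i + 1) = J + i + 1 by ring]
            calc dist (Y (J + i + 1)) b ≤ dist (Y (J + i + 1)) (Y (J + i)) + dist (Y (J + i)) b := dist_triangle _ _ _
              _ < δ / 2 + δ / 2 := add_lt_add hd' hdb
              _ = δ := by ring⟩
          exact hsep _ (thickening_mono (by linarith) _ h) h1
        · exact h
  -- step 4: the other piece still carries a cluster point — contradiction
  obtain ⟨a, haC, hat⟩ := hAt
  obtain ⟨b, hbC, hbt'⟩ := hBt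
  have hfa : ∃ᶠ j in atTop, Y j ∈ ball a (δ / 2) := haC.frequently (ball_mem_nhds a hδ2)
  have hfb : ∃ᶠ j in atTop, Y j ∈ ball b (δ / 2) := hbC.frequently (ball_mem_nhds b hδ2)
  rcases (hJ J le_rfl).1 with hJA | hJB
  · obtain ⟨j, hj, hjb⟩ := (frequently_atTop.1 hfb) J
    obtain ⟨i, rfl⟩ : ∃ i, j = J + i := ⟨j - J, by omega⟩
    have h1 : Y (J + i) ∈ thickening (δ / 2) B := mem_thickening_iff.2 ⟨b, ⟨hbC, hbt'⟩, mem_ball.1 hjb⟩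
    exact hsep _ (thickening_mono (by linarith) _ (hstayA hJA i)) (thickening_mono (by linarith) _ h1)
  · obtain ⟨j, hj, hja⟩ := (frequently_atTop.1 hfa) J
    obtain ⟨i, rfl⟩ : ∃ i, j = J + i := ⟨j - J, by omega⟩
    have h1 : Y (J + i) ∈ thickening (δ / 2) A := mem_thickening_iff.2 ⟨a, ⟨haC, hat⟩, mem_ball.1 hja⟩
    exact hsep _ (thickening_mono (by linarith) _ h1) (thickening_mono (by linarith) _ (hstayB hJB i))

/-- **Unique cluster point in a compact set ⇒ convergence.** [folklore] -/
theorem tendsto_of_forall_mapClusterPt_eq {Y : ℕ → α} {K : Set α} (hK : IsCompact K) (hYK : ∀ j, Y j ∈ K) {ys : α}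
    (huniq : ∀ z, MapClusterPt z atTop Y → z = ys) : Tendsto Y atTop (𝓝 ys) := by
  by_contra hnot
  obtain ⟨s, hs, hfreq⟩ := not_tendsto_iff_exists_frequently_notMem.1 hnot
  obtain ⟨ε, hε, hball⟩ := Metric.mem_nhds_iff.1 hs
  have hfreq' : ∃ᶠ j in atTop, Y j ∉ ball ys ε := hfreq.mono fun j hj hb => hj (hball hb)
  obtain ⟨φ, hφ, hφP⟩ := extraction_of_frequently_atTop hfreq'
  have hK' : IsCompact (K \ ball ys ε) := hK.diff isOpen_ball
  obtain ⟨z, hzK', ψ, hψ, hlim⟩ := hK'.tendsto_subseq (x := Y ∘ φ) fun j => ⟨hYK _, hφP j⟩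
  have hzC : MapClusterPt z atTop Y := by
    have h1 : MapClusterPt z atTop ((Y ∘ φ) ∘ ψ) := hlim.mapClusterPt
    exact (h1.of_comp hψ.tendsto_atTop).of_comp hφ.tendsto_atTop
  have := huniq z hzC
  exact hzK'.2 (by rw [this]; exact mem_ball_self hε)

end Generic

/-! ### Countably many permanent nodes per ball suffice -/

variable {u : ℝ → EuclideanSpace ℝ (Fin 3) → EuclideanSpace ℝ (Fin 3)} {p : ℝ → EuclideanSpace ℝ (Fin 3) → ℝ} {ρ l : ℝ}

/-- **CONVERGENCE TO ONE NODE, COUNTABLE FORM.**  `(u,p)` classical on `(−∞,0)`, `l`-DSS; `X` a particle path confined to `‖X(s)‖ ≤ R(−s)ⁿ` for `s ≤ τ₀` and at rest;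
the permanent nodes of the closed ball `‖y‖ ≤ R` form a COUNTABLE set.  Then the similarity positions at the lattice times `Tʲτ₀` converge to a permanent node of the
ball (the cluster set is a connected set of permanent nodes, and countable sets are totally disconnected). [folklore] -/
theorem exists_tendsto_lattice_of_countable_nodes (hcl : IsClassicalEulerSolutionOn (Iio 0) 0 u p) (hl : 1 < l) (hρ : 0 < 2 + ρ)
    (hdss : ∀ τ : ℝ, τ < 0 → ∀ y, u τ y = (l ^ (1 + ρ)) • u ((l ^ (2 + ρ)) * τ) (l • y))
    {X : ℝ → EuclideanSpace ℝ (Fin 3)} (hX : ∀ s : ℝ, s < 0 → HasDerivAt X (u s (X s)) s)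
    (hrest : Tendsto (fun s => (-s) ^ (1 - (2 + ρ)⁻¹) * ‖u s (X s) + ((2 + ρ)⁻¹ / (-s)) • X s‖) atBot (𝓝 0))
    {τ₀ R : ℝ} (hτ₀ : τ₀ < 0) (hconf : ∀ s : ℝ, s ≤ τ₀ → ‖X s‖ ≤ R * (-s) ^ (2 + ρ)⁻¹)
    (hcount : {y : EuclideanSpace ℝ (Fin 3) | ‖y‖ ≤ R ∧
      ∀ t : ℝ, t < 0 → u t ((-t) ^ (2 + ρ)⁻¹ • y) = (-((2 + ρ)⁻¹ * (-t) ^ ((2 + ρ)⁻¹ - 1))) • y}.Countable) :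
    ∃ ys : EuclideanSpace ℝ (Fin 3), ‖ys‖ ≤ R ∧
      (∀ t : ℝ, t < 0 → u t ((-t) ^ (2 + ρ)⁻¹ • ys) = (-((2 + ρ)⁻¹ * (-t) ^ ((2 + ρ)⁻¹ - 1))) • ys) ∧
      Tendsto (fun j : ℕ => ((-((l ^ (2 + ρ)) ^ j * τ₀)) ^ (-(2 + ρ)⁻¹)) • X ((l ^ (2 + ρ)) ^ j * τ₀)) atTop (𝓝 ys) := by
  have hl0 : 0 < l := zero_lt_one.trans hl
  set n : ℝ := (2 + ρ)⁻¹ with hn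
  set T : ℝ := l ^ (2 + ρ) with hT
  have hT1 : 1 < T := Real.one_lt_rpow hl hρ
  have hT0 : 0 < T := zero_lt_one.trans hT1
  set N : Set (EuclideanSpace ℝ (Fin 3)) := {y | ‖y‖ ≤ R ∧
    ∀ t : ℝ, t < 0 → u t ((-t) ^ n • y) = (-(n * (-t) ^ (n - 1))) • y} with hNdef
  set Y : ℕ → EuclideanSpace ℝ (Fin 3) := fun j => ((-(T ^ j * τ₀)) ^ (-n)) • X (T ^ j * τ₀) with hY
  have hsj0 : ∀ j : ℕ, T ^ j * τ₀ < 0 := fun j => mul_neg_of_pos_of_neg (pow_pos hT0 _) hτ₀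
  have hsjτ : ∀ j : ℕ, T ^ j * τ₀ ≤ τ₀ := fun j => by
    have : 1 ≤ T ^ j := one_le_pow₀ hT1.le
    nlinarith
  have hs_bot : Tendsto (fun j : ℕ => T ^ j * τ₀) atTop atBot :=
    (tendsto_pow_atTop_atTop_of_one_lt hT1).atTop_mul_const_of_neg hτ₀
  have hneg_inv : ∀ s : ℝ, s < 0 → (-s) ^ (-n) = ((-s) ^ n)⁻¹ := fun s hs => Real.rpow_neg (by linarith) n
  have hYR : ∀ j, ‖Y j‖ ≤ R := by
    intro j
    have hs0 : 0 < -(T ^ j * τ₀) := by linarith [hsj0 j]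
    have hp : 0 < (-(T ^ j * τ₀)) ^ n := Real.rpow_pos_of_pos hs0 _
    simp only [hY]
    rw [norm_smul, Real.norm_eq_abs, hneg_inv _ (hsj0 j), abs_of_pos (inv_pos.2 hp), inv_mul_le_iff₀ hp]
    linarith [hconf _ (hsjτ j)]
  have hK : IsCompact (closedBall (0 : EuclideanSpace ℝ (Fin 3)) R) := isCompact_closedBall _ _
  have hYK : ∀ j, Y j ∈ closedBall (0 : EuclideanSpace ℝ (Fin 3)) R := fun j => mem_closedBall_zero_iff.2 (hYR j)
  -- cluster points are permanent nodes of the ball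
  have hcluster : ∀ z, MapClusterPt z atTop Y → z ∈ N := by
    intro z hz
    obtain ⟨φ, hφ, hlim⟩ := hz.tendsto_subseq
    refine ⟨le_of_tendsto' (continuous_norm.continuousAt.tendsto.comp hlim) fun j => hYR _, ?_⟩
    exact permanentNode_of_tendsto_simPos hcl hl hρ hdss hX hrest (sq := fun j => T ^ (φ j) * τ₀) (fun j => hsj0 _)
      (hs_bot.comp hφ.tendsto_atTop) hlim
  -- successive positions are close
  have hstep : Tendsto (fun j => dist (Y (j + 1)) (Y j)) atTop (𝓝 0) := by
    rw [Metric.tendsto_atTop]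
    intro ε hε
    have hε' : 0 < ε / (2 * T) := by positivity
    obtain ⟨M, hM⟩ := eventually_atBot.1 (hrest.eventually (gt_mem_nhds hε'))
    obtain ⟨J, hJ⟩ := eventually_atTop.1 (hs_bot.eventually (eventually_le_atBot M))
    refine ⟨J, fun j hj => ?_⟩
    rw [dist_zero_right, Real.norm_eq_abs, abs_of_nonneg dist_nonneg]
    have hs's : T ^ (j + 1) * τ₀ ≤ T ^ j * τ₀ := by
      have h := hsj0 j
      rw [pow_succ]; nlinarith [h, hT1]
    have hmv := norm_simPos_sub_le (u := u) (n := n) (T := T) (ε := ε / (2 * T)) (s' := T ^ (j + 1) * τ₀) (s := T ^ j * τ₀)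
      (hsj0 j) hs's (le_of_eq (by rw [pow_succ]; ring)) hX
      (fun σ hσ => by
        rw [norm_smul, Real.norm_eq_abs, abs_of_nonneg (Real.rpow_nonneg (by linarith [hσ.2, hsj0 j]) _)]
        exact (hM σ (hσ.2.trans (hJ j hj))).le)
    rw [dist_eq_norm, ← norm_neg, neg_sub]
    simp only [hY]
    refine lt_of_le_of_lt hmv ?_
    rw [div_mul_eq_mul_div, div_lt_iff₀ (by positivity)]
    nlinarith
  -- the cluster set is a connected subset of the countable node set: a single node
  have hconn := isPreconnected_setOf_mapClusterPt hK hYK hstep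
  have hsubN : {z | MapClusterPt z atTop Y} ⊆ N := fun z hz => hcluster z hz
  have hsubs : ({z | MapClusterPt z atTop Y} : Set (EuclideanSpace ℝ (Fin 3))).Subsingleton :=
    hcount.isTotallyDisconnected _ hsubN hconn
  obtain ⟨ys, -, ψ, hψ, hlim⟩ := hK.tendsto_subseq hYK
  have hysC : MapClusterPt ys atTop Y := (hlim.mapClusterPt).of_comp hψ.tendsto_atTop
  refine ⟨ys, (hcluster ys hysC).1, (hcluster ys hysC).2, ?_⟩
  exact tendsto_of_forall_mapClusterPt_eq hK hYK fun z hz => hsubs hz hysC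

end Summit.NavierStokesRegularity.NavierStokesRegularity.Theorems.PowerGaugeEulerLiouville.DSSNodes

end
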